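import Mathlib
import HarnessLib
import HarnessLib.Audit
import Summits.PneNP.Statement
import Literature.Computability.Complexity.Classes
import Literature.Computability.Complexity.Nondeterministic
import Literature.Computability.Complexity.CookBridges
import Literature.Computability.Complexity.CircuitClasses
import Literature.Computability.Complexity.ConstantDepth
import Literature.Computability.MetaComplexity.MCSP
import Literature.Computability.MetaComplexity.MCSPProofs
import Literature.Computability.MetaComplexity.NaturalProofs

/-!
Route: RootDecompMcspDepth

DORMANT since 2026-09-04T14:28:24Z (reconciler: no traction for 5 d (last activity statement-checked at 2026-08-30T13:34:34Z); parked, not closed — `ledger route dormant route-PneNP-RootDecompMcspDepth --off` to reactivate) — unstaffed, not closed; items shared with open routes are served there. `ledger route dormant <id> --off` reactivates.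

Root-decomposition cell decomp-pnenp (D-0178), node N39 = proposal P41 (lens-3 gen 8
«RootDecompMcspDepth / McspDepthDial», HOME/decomp-pnenp-lens-3/McspDepthDial.lean sha256 06b59e75;
critic CLEARED 2026-08-30T08:52:33Z, W1 thin route, LOW priority). It suffices to show the two
pieces of the cut of P ≠ NP at the bit Y(TC0) «MCSP ∉ TC0» in the cell's collapse-hypothesis shape:
McspTC0Transfer «NP ⊆ P ⟹ MCSP ∉ TC0» (attacked; located S-free sub-target = aside MCSPNotTC0 with
roads (i) TC0 ≠ NC1 mod the GIIKKT binder NC1ViaMCSPTC0 and (ii) Razborov–Rudich inverted mod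
McspNatural) and McspTC0Shallow «NP ⊆ P ⟹ MCSP ∈ TC0» (declared residual: below N4's
ThresholdShallow 26499 by name; candidate strictness = OS17's open implication, census test T_MD2).
S ⟺ McspTC0Transfer ∧ McspTC0Shallow hypothesis-free (pack pneNP_iff). The coordinate is the DEPTH
CLASS OF MCSP ITSELF — the constructivity of the universal natural property — with a
kernel-calibrated dial (bottom AC0 / AC0[p] decided, top PPoly costume, ACC0 / TC0 / NC1 open).
Lean: McspTC0Transfer → McspTC0Shallow → PneNP

Rationale: WHY THIS LINE. The census of Kolmogorov cut bits (N11 succinct-MCSP reduction exponent, N16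
Kt-perebor exponent, N28 explicit-randomness exponent) is closed («no fourth Kolmogorov axis will
score without a new lever», critic 07:35/07:50Z) and N4 / N25 / lens-2 dial the depth of P through a
P-complete EvalLang; the NEW LEVER is the circuit depth Γ of the universal natural property itself:
Y(Γ) := MCSP ∉ Γ on the tree chain AC0 ⊆ AC0[p] ⊆ ACC0 ⊆ TC0 ⊆ NC1 ⊆ PPoly. The dial is calibrated
in kernel modulo named binders — bottom cells decided (ABKvMR06, GIIKKT19 Thm 1.1 via the sandwich
and the tree's Smolensky), top cell costume by theorem (MCSP ∈ NP; Y(PPoly) = hub 0262 by Iff.rfl),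
middle cells open in print (GIIKKT19 p.9, OS17 p.39) — and every bit is interleaved with the
classical separations: NC1 ⊄ Γ ⟹ Y(Γ) ⟹ NP ⊄ Γ (GIIKKT Cor 5.2; MCSP ∈ NP), so Y(TC0) ⟹ hub 0039 ⟹
N4 26497 and 26499 ⟹ R, with the MEET LAW «MCSP column = class column iff OS17's implication»
(PPolyViaMCSP). The natural-proofs barrier, the one priced obstruction to «MCSP ∉ TC0», is VOID
under the attacked piece's own hypothesis (Algorithmica has P/poly-natural proofs) — a typed fact no
class-dial node had. Imported: meta-complexity of MCSP (Kabanets–Cai, ABKvMR06, GIIKKT19, OS17),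
Razborov–Rudich natural proofs (tree vocabulary), the tree's constant-depth chain, law D.
RANKED CRUXES. r2 McspTC0Transfer (attacked; located target = aside MCSPNotTC0; roads (i)/(ii)). r3
McspTC0Shallow (declared residual ≤ 26499 by name; candidate strictness T_MD2; pre-costume mod
MCSPNotTC0). Asides (never staffed): MCSPNotTC0 (located target), NC1ViaMCSPTC0 (GIIKKT19 Cor 5.2
cite fact, port), McspNaturalPPoly (provable-now support of the NAT-void law). Not filed: hub cruxes
0039 / 0037 / 10624 / 0262 and N4 items 26497 / 26499 / 23745 / 23746 (cited BY NAME in the edges),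
the farm-unbuilt chain facts ACC0_subset_TC0 / TC0_subset_NC1 / PARITY_mem_NC1 (tree named facts,
binders in the lens), PPolyViaMCSP TC0 (OS17 open = T_MD2), the other cells of the dial (lens §9
ledger).
KILL CRITERIA. (k1) T_MD2 decided «coincide» (OS17's implication MCSP ∈ TC0 ⟹ P/poly ⊆ TC0 proved,
even only inside Algorithmica): R ≡ 26499 and A ≡ 26497 — the cell IS N4's threshold cut; retire
`superseded --by route-PneNP-RootDecompAccTransfer` keeping the interleaving edges in TREE; (k2) a
proof of MCSP ∉ TC0 closes McspTC0Transfer and makes McspTC0Shallow ≡ S (pre-costume, declared) —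
node DECIDED with residual = summit: honest retirement «road closed, residual = summit»; (k3) a
proof of MCSP ∈ TC0 outright (would give NC1 ⊆ TC0 by GIIKKT) makes McspTC0Transfer ≡ S — retire
located-costume; (k4) T_MD1 decided «inconsistent» (NP ⊆ P ⟹ TC0 = NC1 or ⟹ MCSP ∈ TC0 proved): A ≡
S, same retirement.
NOT DECOMPOSED YET. The other dial cells (ACC0: road via MAJ ∉ ACC0 / Chen–Tell MajClosure and N4
23745 / 23746; NC1; AC0[p] bottom rungs as calibration facts once Smolensky / PARITY_mem_NC1 modules
build); the ports of NC1ViaMCSPTC0 (GIIKKT19 §5) and McspNaturalPPoly (size M each); the chain facts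
ACC0 ⊆ TC0 ⊆ NC1 (tree _holds theorems, farm-unbuilt); OS17's implication PPolyViaMCSP as the
instrument of T_MD2; the cryptographic upper road HardPRFInTC0 ⟹ NoNaturalProofs PPoly (tree
Literature.Barriers.PneNP.NaturalProofsTC0, by name).
CHEAPEST FALSIFIER. In Lean: `#h21_crux_probe` on both pieces vs PneNP (run in the pack: CLEAN, C →
S fails) and the lens's bc2 4/4 / bc4 4/4 must-fail probes (all fail; critic spot-read). In print: a
theorem «NP ⊆ P ⟹ MCSP ∈ TC0» (R outright; e.g. via OS17's implication plus P ⊆ TC0-type collapses)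
or «MCSP ∈ TC0 ⟹ P/poly ⊆ TC0» (decides T_MD2) — searched (OS17, GIIKKT19, Allender–Koucký 2010,
Murray–Williams 2017, Hirahara 2018–2022): only NC1 ⊆ TC0 from MCSP ∈ TC0 is known.

Novelty: Searches RUN (lens g8 NODE-g8.md + critic + writer): `lean search 'MCSP'` (tree: MCSP.lean /
MCSPProofs.lean — MCSP ∈ NP, certified-hard counting; hub item Circuit2.CircuitMcspNotPpoly 0262 =
Y(PPoly) by Iff.rfl; no depth-class statement about MCSP below PPoly before this node), `lean search
'IsNatural|IsUsefulAgainst|HardPRFInTC0'` (tree natural-proofs vocabulary and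
Literature.Barriers.PneNP.NaturalProofsTC0), `ledger negatives --problem PneNP` (no statement on
MCSP vs TC0 / ACC0 / NC1); corpus `lit search --hybrid "MCSP TC0 lower bound natural proofs constant
depth"` → [corpus:paper:doi-10-4230-lipics-icalp-2019-66 p.2, p.8, p.9] GIIKKT19 (Thm 1.1, Cor 5.2,
Cor 5.7, p.9), Oliveira–Santhanam arXiv:1611.01190 p.39 (the open implication), ABKvMR06,
Allender–Koucký JACM 2010 (amplification for TC0 vs NC1), Murray–Williams Theory Comput. 2017 (MCSP
hardness caveats), Hirahara–Santhanam CCC 2017; galaxy `lit galaxy search "MCSP|minimum circuit size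
problem|TC0" --star all` → the same cluster + Kabanets–Cai 2000; no result deriving MCSP ∈ TC0 from
NP ⊆ P or P/poly ⊆ TC0 from MCSP ∈ TC0. Versus the cell's routes: N11 McspDial / N16 KtPerebor / N28
ExplicitRandom dial Kolmogorov EXPONENTS or REDUCTIONS TO MCSP, N4 AccTransfer / N25
DepthTwoThreshold / N32 DepthDial dial the depth of P via a P-complete language, hub 0039 / 0037 /
10624 are the bare class separations — none cuts along the depth class of MCSP itself, none has the
NAT-void-under-guard law or the MEET LAW with OS17's im  [refs: 1611.01190, paper:doi-10-4230-lipics-icalp-2019-66]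

Barriers (technique_class: MCSP depth dial, natural proofs inverted, law-D-carving): - technique_class: meta-complexity of MCSP on the constant-depth chain; natural proofs inverted
(PRFs vs shallow distinguishers); GIIKKT sandwich; law-D carving
- Literature.Barriers.PneNP.NaturalProofsTC0 (RR97 + Naor–Reingold TC0-PRFs): the located target
MCSPNotTC0 is INSIDE its scope in the S-world (a natural proof of MCSP ∉ TC0 is priced conditionally
on HardPRFInTC0) — road (ii) is OUTSIDE by construction (it USES the PRF family as the proof:
Razborov–Rudich inverted), road (i) goes through TC0 ≠ NC1 (Allender–Koucký amplification, not a
natural property of MCSP); and for the attacked piece AS TYPED the barrier is VOID: under its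
hypothesis NP ⊆ P, Algorithmica has P/poly-natural useful properties (pack
not_noNaturalProofs_of_not_pneNP mod McspNaturalPPoly), so HardPRFInTC0 fails there.
- Literature.Barriers.PneNP.naturalProofsTC0_of_subexpDDH (the DDH-discharged form of the TC0
natural-proofs barrier): same placement as NaturalProofsTC0 — it prices P/poly-natural properties
useful against TC0 in the S-world; road (ii) is the non-natural use of exactly such PRF families,
road (i) is TC0 ≠ NC1, and under the attacked piece's hypothesis NP ⊆ P the DDH-type assumption
itself fails (Algorithmica breaks subexponential DDH), so the discharged barrier is VOID for the
piece as typed; the residual is priced as a residual.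
- Literature.Barriers.PneNP.MCSPKarpHardness (KabanetsCai2000 / MurrayWilliams2017: consequences of
NP-hardness of MCSP under Karp / local / natural reductions

History (route lifecycle, newest last):
- 2026-09-04T14:28:24Z · DORMANT — reconciler: no traction for 5 d (last activity statement-checked at 2026-08-30T13:34:34Z); parked, not closed — `ledger route dormant route-PneNP-RootDecompMcsp (operator:999:982476)

sub-problem: PneNP · status: dormant · opened planner-decomp-pnenp-writer-1-g5-0 2026-08-30T10:10:56Z · rev 0 · ledger route-PneNP-RootDecompMcspDepth
GENERATED by the gate from the ledger (D-0016/17). Provers cite these decls: `theorem foo : Summit.PneNP.PneNP.Theses.RootDecompMcspDepth.<Decl> := …` in Summits/PneNP/PneNP/Theorems/<Name>.lean.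
-/

namespace Summit.PneNP.PneNP.Theses.RootDecompMcspDepth

open scoped BigOperators Topology Manifold Classical MeasureTheory ProbabilityTheory Matrix InnerProductSpace ComplexConjugate ContinuousMap
open Filter Set Function TopologicalSpace MeasureTheory

attribute [summit_statement] _root_.PneNP

open Literature.PNP

/-- item stmt-PneNP-32045 · crux · rank 2 · open · by planner
why it might fail: Its S-free core MCSP ∉ TC0 is an explicit TC0 lower bound (open: GIIKKT19 p.9, OS17 p.39); road (i) needs TC0 ≠ NC1, road (ii) needs PRF-type families secure against TC0 truth-table distinguishers — neither is in sight, and under ¬S only the natural-proofs barrier is voided, not the lower bound.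
sources: arXiv:1611.01190 Oliveira–Santhanam, Conspiracies between learning algorithms, circuit lower bounds and pseudorandomness (CCC 2017), p.39 open problems: «if MCSP ∈ TC0 then NC1 ⊆ TC0; prove that if MCSP ∈ TC0 then Circuit[poly] ⊆ TC0», [corpus:paper:doi-10-4230-lipics-icalp-2019-66 p.2, p.8, p.9] Golovnev–Ilango–Impagliazzo–Kabanets–Kolokolova–Tal, AC0[p] lower bounds against MCSP via the coin problem, ICALP 2019: Thm 1.1, Cor 5.2 (NC1 ⊆ (AC0)^MCSP), Cor 5.7, p.9 «we don't know how to disprove MCSP ∈ ACC0», Allender–Buhrman–Koucký–van Melkebeek–Ronneburger, Power from random strings, SIAM J. Comput. 35(6) (2006) 1467–1493 (MCSP ∉ AC0), RazborovRudich1997 (JCSS 55: natural proofs; tree Literature.Computability.MetaComplexity.NaturalProofs: CombinatorialProperty / IsNatural / IsUsefulAgainst; Literature.Barriers.PneNP.NaturalProofs, NaturalProofsTC0), hub cruxes stmt-PneNP-0039 Circuit.CircuitNpTc0, 0037 CircuitNpAcc0, 10624 CircuitThesis, 0262 Circuit2.CircuitMcspNotPpoly (cited BY NAME: lens circuitNpTc0_of_bit,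 circuit2_item_iff := Iff.rfl), HOME/decomp-pnenp-lens-3/McspDepthDial.lean sha256 06b59e75
[crux r2 · piece A «transfer» · ATTACKED · tags WEAKER(formal: S ⟹ A, lens transfer_of_pneNP;
strictness world «NP ⊆ P ∧ TC0 ≠ NC1» excluded by nothing known = census test T_MD1) / NECESSARY
(pack pneNP_iff) / not-COSTUME as typed (lens bc2 4/4, bc4 4/4 fail, bc7 CLEAN; writer bc7 CLEAN) /
UNDECIDED / leaf IDEA-NEEDED·LOCATED] THE CUT PREDICATE Y(TC0) := MCSP ∉ TC0 «the Minimum Circuit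
Size Problem (tree language MCSP, Kabanets–Cai) has no non-uniform constant-depth polynomial-size
threshold circuits» — the universal natural property is not TC0-constructive; the DIAL Y(Γ) := MCSP
∉ Γ runs over the tree chain AC0 ⊆ AC0[p] ⊆ ACC0 ⊆ TC0 ⊆ NC1 ⊆ PPoly with BOTTOM cells decided in
print (MCSP ∉ AC0, ABKvMR06; MCSP ∉ AC0[p], GIIKKT19 Thm 1.1 — in kernel for odd p mod the sandwich
binder and tree Smolensky) = costume ends, TOP Γ = PPoly costume by theorem (MCSP ∈ NP; Y(PPoly) =
hub item 0262 by Iff.rfl ⟹ S), OPEN cells ACC0 / TC0 / NC1 (GIIKKT19 p.9, OS17 p.39); notch of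
record Γ = TC0. Piece A: «in Algorithmica (NP ⊆ P), MCSP ∉ TC0». LOCATED S-FREE SUB-TARGET = aside
MCSPNotTC0 (pack transfer_of_MCSPNotTC0), ABSENT from forest and census before this node (critic).
S-FREE ROADS: (i) TC0 ≠ -/
@[route_item "route-PneNP-RootDecompMcspDepth"]
def McspTC0Transfer : Prop :=
  Literature.Computability.Complexity.Nondeterministic.NP ⊆ Literature.Computability.Complexity.Classes.P → Literature.Computability.MetaComplexity.MCSP ∉ Literature.Computability.Complexity.TC0

/-- item stmt-PneNP-32046 · crux · rank 3 · open · by planner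
why it might fail: Pre-costume: equivalent to S as soon as MCSP ∉ TC0 is proved (pack shallow_iff_pneNP_of_MCSPNotTC0); and it may coincide with N4's 26499 (iff OS17's open implication MCSP ∈ TC0 ⟹ P/poly ⊆ TC0 holds inside Algorithmica, test T_MD2) — then the cell adds no residual below the class column.
sources: arXiv:1611.01190 Oliveira–Santhanam, Conspiracies between learning algorithms, circuit lower bounds and pseudorandomness (CCC 2017), p.39 open problems: «if MCSP ∈ TC0 then NC1 ⊆ TC0; prove that if MCSP ∈ TC0 then Circuit[poly] ⊆ TC0», [corpus:paper:doi-10-4230-lipics-icalp-2019-66 p.2, p.8, p.9] Golovnev–Ilango–Impagliazzo–Kabanets–Kolokolova–Tal, AC0[p] lower bounds against MCSP via the coin problem, ICALP 2019: Thm 1.1, Cor 5.2 (NC1 ⊆ (AC0)^MCSP), Cor 5.7, p.9 «we don't know how to disprove MCSP ∈ ACC0», N4 route-PneNP-RootDecompAccTransfer items stmt-PneNP-26497 ThresholdTransfer / 26499 ThresholdShallow / 23745 TransferACC0 / 23746 ShallowAlgorithmica (cited BY NAME: lens thresholdShallow_iff := Iff.rfl, shallow_of_thresholdShallow, thresholdTransfer_of_transfer),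 HOME/decomp-pnenp-lens-3/McspDepthDial.lean sha256 06b59e75, HOME/decomp-pnenp-lens-3/mdd/NODE-g8.md sha256 26b1e580
[crux r3 · piece R «shallow» · DECLARED RESIDUAL (tribunal_fit.residual; fallback label; tag
«candidate ≤ 26499 pending T_MD2; pre-costume mod MCSP ∉ TC0»; NO residual score claimed) · tags
WEAKER(formal: S ⟹ R, lens shallow_of_pneNP) / NECESSARY / not-COSTUME as typed / PRE-COSTUME
declared (pack shallow_iff_pneNP_of_MCSPNotTC0: once the located target MCSP ∉ TC0 is a theorem, R ≡
S) / UNDECIDED / leaf INSTRUMENTABLE (T_MD2) · residual] THE CUT PREDICATE Y(TC0) := MCSP ∉ TC0 «the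
Minimum Circuit Size Problem (tree language MCSP, Kabanets–Cai) has no non-uniform constant-depth
polynomial-size threshold circuits» — the universal natural property is not TC0-constructive; the
DIAL Y(Γ) := MCSP ∉ Γ runs over the tree chain AC0 ⊆ AC0[p] ⊆ ACC0 ⊆ TC0 ⊆ NC1 ⊆ PPoly with BOTTOM
cells decided in print (MCSP ∉ AC0, ABKvMR06; MCSP ∉ AC0[p], GIIKKT19 Thm 1.1 — in kernel for odd p
mod the sandwich binder and tree Smolensky) = costume ends, TOP Γ = PPoly costume by theorem (MCSP ∈
NP; Y(PPoly) = hub item 0262 by Iff.rfl ⟹ S), OPEN cells ACC0 / TC0 / NC1 (GIIKKT19 p.9, OS17 p.39);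
notch of record Γ = TC0. Piece R: «in Algorithmica, MCSP ∈ TC0» — the universal natural property
becomes TC0-construc -/
@[route_item "route-PneNP-RootDecompMcspDepth"]
def McspTC0Shallow : Prop :=
  Literature.Computability.Complexity.Nondeterministic.NP ⊆ Literature.Computability.Complexity.Classes.P → Literature.Computability.MetaComplexity.MCSP ∈ Literature.Computability.Complexity.TC0

/-- item stmt-PneNP-32047 · aside · rank 9 · open · by planner
why it might fail: An explicit TC0 lower bound for an NP language: blocked for natural proofs by TC0-PRFs (Literature.Barriers.PneNP.NaturalProofsTC0) unless the proof is non-natural — road (ii) uses exactly the PRFs, road (i) needs TC0 ≠ NC1; both open.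
sources: arXiv:1611.01190 Oliveira–Santhanam, Conspiracies between learning algorithms, circuit lower bounds and pseudorandomness (CCC 2017), p.39 open problems: «if MCSP ∈ TC0 then NC1 ⊆ TC0; prove that if MCSP ∈ TC0 then Circuit[poly] ⊆ TC0», [corpus:paper:doi-10-4230-lipics-icalp-2019-66 p.2, p.8, p.9] Golovnev–Ilango–Impagliazzo–Kabanets–Kolokolova–Tal, AC0[p] lower bounds against MCSP via the coin problem, ICALP 2019: Thm 1.1, Cor 5.2 (NC1 ⊆ (AC0)^MCSP), Cor 5.7, p.9 «we don't know how to disprove MCSP ∈ ACC0», RazborovRudich1997 (JCSS 55: natural proofs; tree Literature.Computability.MetaComplexity.NaturalProofs: CombinatorialProperty / IsNatural / IsUsefulAgainst; Literature.Barriers.PneNP.NaturalProofs, NaturalProofsTC0), hub cruxes stmt-PneNP-0039 Circuit.CircuitNpTc0, 0037 CircuitNpAcc0, 10624 CircuitThesis, 0262 Circuit2.CircuitMcspNotPpoly (cited BY NAME: lens circuitNpTc0_of_bit, circuit2_item_iff := Iff.rfl), HOME/decomp-pnenp-lens-3/McspDepthDial.lean sha256 06b59e75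
[aside · LOCATED S-FREE TARGET of the attacked side · never staffed, never counted (bc6 aside) ·
INCOMPARABLE with S as a target (implies S only through Y(TC0) ⟹ NP ⊄ TC0, not NP ⊄ P)] «MCSP ∉
TC0»: the Minimum Circuit Size Problem has no polynomial-size constant-depth threshold circuits —
OPEN (GIIKKT19 p.9 / Cor 5.7 «either NEXP ⊄ P/poly or MCSP ∉ ACC0»; OS17 p.39). Closes
McspTC0Transfer outright (pack transfer_of_MCSPNotTC0) and turns McspTC0Shallow into the summit
(pack shallow_iff_pneNP_of_MCSPNotTC0); gives hub 0039 CircuitNpTc0 (lens circuitNpTc0_of_bit, MCSP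
∈ NP). Roads: (i) from TC0 ≠ NC1 mod NC1ViaMCSPTC0; (ii) from NoNaturalProofs TC0 mod McspNatural
TC0 (Razborov–Rudich inverted); in the cryptographic world (TC0-PRFs, Naor–Reingold; tree
HardPRFInTC0 ⟸ SubexpDDH) it is expected TRUE. PROVENANCE: root-decomposition cell decomp-pnenp
(D-0178), proposal P41 = lens-3 gen 8 NODE «RootDecompMcspDepth / McspDepthDial»
(HOME/decomp-pnenp-lens-3/McspDepthDial.lean sha256 06b59e75;
HOME/decomp-pnenp-lens-3/mdd/NODE-g8.md sha256 26b1e580); critic decomp-pnenp-crit-1 g4 NODE-VERDICT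
2026-08-30T08:52:33Z CLEARED (0 blocking objections; S-INERT-LEANING LOCATED CELL on the NEW coord -/
@[route_item "route-PneNP-RootDecompMcspDepth"]
def MCSPNotTC0 : Prop :=
  Literature.Computability.MetaComplexity.MCSP ∉ Literature.Computability.Complexity.TC0

/-- item stmt-PneNP-32048 · aside · rank 9 · open · by planner
why it might fail: The port needs the tree's TC0 (DepthSizeClass over tcBasis) to be closed under the non-uniform AC0-oracle / truth-table reductions of GIIKKT19 §5 with the tree's MCSP encoding; a convention mismatch (gap-MCSP vs exact MCSP, advice) could force a re-typing.
sources: [corpus:paper:doi-10-4230-lipics-icalp-2019-66 p.2, p.8, p.9] Golovnev–Ilango–Impagliazzo–Kabanets–Kolokolova–Tal, AC0[p] lower bounds against MCSP via the coin problem, ICALP 2019: Thm 1.1, Cor 5.2 (NC1 ⊆ (AC0)^MCSP), Cor 5.7, p.9 «we don't know how to disprove MCSP ∈ ACC0», arXiv:1611.01190 Oliveira–Santhanam, Conspiracies between learning algorithms, circuit lower bounds and pseudorandomness (CCC 2017), p.39 open problems: «if MCSP ∈ TC0 then NC1 ⊆ TC0; prove that if MCSP ∈ TC0 then Circuit[poly]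 ⊆ TC0», HOME/decomp-pnenp-lens-3/McspDepthDial.lean sha256 06b59e75
[aside · PRINT BINDER (cite fact) of road (i) and of the residual-side sandwich · provable from the
literature (a port of GIIKKT19 Cor 5.2 / OS17: NC1 ⊆ (AC0)^MCSP under non-uniform AC0 oracle
reductions, TC0 closed under them) · never an axiom; bc6 aside] «if MCSP ∈ TC0 then NC1 ⊆ TC0». Used
by pack transfer_of_TC0_ne_NC1 (TC0 ≠ NC1 ⟹ A) and lens NC1_lift_of_mcspShallowIn / sandwich (NC1 ⊄
Γ ⟹ Y(Γ) ⟹ NP ⊄ Γ). PROVENANCE: root-decomposition cell decomp-pnenp (D-0178), proposal P41 = lens-3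
gen 8 NODE «RootDecompMcspDepth / McspDepthDial» (HOME/decomp-pnenp-lens-3/McspDepthDial.lean sha256
06b59e75; HOME/decomp-pnenp-lens-3/mdd/NODE-g8.md sha256 26b1e580); critic decomp-pnenp-crit-1 g4
NODE-VERDICT 2026-08-30T08:52:33Z CLEARED (0 blocking objections; S-INERT-LEANING LOCATED CELL on
the NEW coordinate «depth class Γ of MCSP itself», bit Y(Γ) := MCSP ∉ Γ on the tree chain AC0 ⊆
AC0[p] ⊆ ACC0 ⊆ TC0 ⊆ NC1 ⊆ PPoly, notch Γ = TC0; scored once as a located cell with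
kernel-calibrated dial and typed hub interleaving; NO residual score;
HOME/critic/L3_McspDepthDial_g8_probe.lean sha256 752293e1, farm rc0 / 0 sorry / 124 AXOK; birth
ruling W1 THIN ROUTE, LOW priority, asides MCSPNotTC0 / NC1V -/
@[route_item "route-PneNP-RootDecompMcspDepth"]
def NC1ViaMCSPTC0 : Prop :=
  Literature.Computability.MetaComplexity.MCSP ∈ Literature.Computability.Complexity.TC0 → Literature.Computability.Complexity.NC1 ⊆ Literature.Computability.Complexity.TC0

/-- item stmt-PneNP-32049 · aside · rank 9 · open · by planner
why it might fail: Routine but convention-sensitive: the tree's IsNatural Γ asks for a Γ-decidable LARGE property in its exact density format and IsUsefulAgainst PPoly in its a.e./i.o. format; the 2^{n/4} threshold must match the tree's MCSP parameterisation (size parameter as part of the input).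
sources: RazborovRudich1997 (JCSS 55: natural proofs; tree Literature.Computability.MetaComplexity.NaturalProofs: CombinatorialProperty / IsNatural / IsUsefulAgainst; Literature.Barriers.PneNP.NaturalProofs, NaturalProofsTC0), KabanetsCai2000 (Circuit minimization problem, STOC 2000; tree MCSP_mem_NP_holds, MCSPProofs.lean), HOME/decomp-pnenp-lens-3/McspDepthDial.lean sha256 06b59e75
[aside · SUPPORT, provable now (folklore reading of Razborov–Rudich §2 / Kabanets–Cai 2000) · bc6
aside] «if MCSP ∈ P/poly then some combinatorial property is P/poly-natural and useful against
P/poly»: the property «tt(f) has circuit complexity > 2^{n/4}» — constructivity = one projection of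
MCSP plus a complement, largeness by counting (tree CertifiedHard.uniformProb_MCSPSize_le),
usefulness since SIZE[poly] < 2^{n/4} eventually (tree vocabulary CombinatorialProperty / IsNatural
/ IsUsefulAgainst of Literature.Computability.MetaComplexity.NaturalProofs). It is the binder of the
kernel law «BARRIER[NAT] is VOID under the ¬S-guard» (pack not_noNaturalProofs_of_not_pneNP: in
Algorithmica MCSP ∈ P ⊆ P/poly, hence P/poly-natural proofs against P/poly exist and HardPRFInTC0 is
refuted there) and, at Γ = TC0, of road (ii). PROVENANCE: root-decomposition cell decomp-pnenp
(D-0178), proposal P41 = lens-3 gen 8 NODE «RootDecompMcspDepth / McspDepthDial»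
(HOME/decomp-pnenp-lens-3/McspDepthDial.lean sha256 06b59e75;
HOME/decomp-pnenp-lens-3/mdd/NODE-g8.md sha256 26b1e580); critic decomp-pnenp-crit-1 g4 NODE-VERDICT
2026-08-30T08:52:33Z CLEARED (0 blocking objections; S-INERT-LEANING LOCATED C -/
@[route_item "route-PneNP-RootDecompMcspDepth"]
def McspNaturalPPoly : Prop :=
  Literature.Computability.MetaComplexity.MCSP ∈ Literature.Computability.Complexity.PPoly → ∃ Q : Literature.Computability.MetaComplexity.CombinatorialProperty, Literature.Computability.MetaComplexity.IsNatural Literature.Computability.Complexity.PPoly Q ∧ Literature.Computability.MetaComplexity.IsUsefulAgainst Literature.Computability.Complexity.PPoly Q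

/-- item stmt-PneNP-32050 · assembly · rank 1 · open · by planner
why it might fail: Cannot fail: closes is propositional logic over the tree bridge pneNP_shape_iff_P_ne_NP and P_subset_NP_holds, certified native by route check.
sources: HOME/decomp-pnenp-lens-3/McspDepthDial.lean sha256 06b59e75, writer folder/n39_mcspdepth/N39_items.lean sha256 030c0cca
[assembly] the two pieces give the summit: under ¬S (so NP ⊆ P over the CookBridges model bridge
pneNP_shape_iff_P_ne_NP + P ⊆ NP) they contradict each other — glue.lean `closes` (by_contra; both
binders used); exactness `pneNP_iff : PneNP ↔ McspTC0Transfer ∧ McspTC0Shallow` hyp-free in the pack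
(= lens node_iff = cut_iff TC0). PROVENANCE: root-decomposition cell decomp-pnenp (D-0178), proposal
P41 = lens-3 gen 8 NODE «RootDecompMcspDepth / McspDepthDial»
(HOME/decomp-pnenp-lens-3/McspDepthDial.lean sha256 06b59e75;
HOME/decomp-pnenp-lens-3/mdd/NODE-g8.md sha256 26b1e580); critic decomp-pnenp-crit-1 g4 NODE-VERDICT
2026-08-30T08:52:33Z CLEARED (0 blocking objections; S-INERT-LEANING LOCATED CELL on the NEW
coordinate «depth class Γ of MCSP itself», bit Y(Γ) := MCSP ∉ Γ on the tree chain AC0 ⊆ AC0[p] ⊆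
ACC0 ⊆ TC0 ⊆ NC1 ⊆ PPoly, notch Γ = TC0; scored once as a located cell with kernel-calibrated dial
and typed hub interleaving; NO residual score; HOME/critic/L3_McspDepthDial_g8_probe.lean sha256
752293e1, farm rc0 / 0 sorry / 124 AXOK; birth ruling W1 THIN ROUTE, LOW priority, asides MCSPNotTC0
/ NC1ViaMCSP TC0 / McspNatural PPoly, hub and N4 items by name); census COSTUME-CENSUS v12 -/
@[route_item "route-PneNP-RootDecompMcspDepth"]
def Assembly : Prop :=
  McspTC0Transfer → McspTC0Shallow → PneNP

/-! D-0027 §2.1 — DECIDING THEOREM (planner-authored via `route open/edit --closes-file`; by planner-decomp-pnenp-writer-1-g5-0 2026-08-30T10:10:56Z):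
its hypotheses are this route's items and its conclusion the sub-problem Statement (glue_lint), and it elaborates with this file. -/

@[closes "route-PneNP-RootDecompMcspDepth"] theorem closes (hA : McspTC0Transfer) (hR : McspTC0Shallow) : _root_.PneNP := by
  by_contra hS
  have hPNP : Literature.Computability.Complexity.Classes.P =
      Literature.Computability.Complexity.Nondeterministic.NP := by
    by_contra hne
    exact hS (Literature.Computability.Complexity.pneNP_shape_iff_P_ne_NP.2 hne)
  have hNP : Literature.Computability.Complexity.Nondeterministic.NP ⊆
      Literature.Computability.Complexity.Classes.P := fun L hL => by rw [hPNP]; exact hL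
  exact hA hNP (hR hNP)

end Summit.PneNP.PneNP.Theses.RootDecompMcspDepth
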